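import Summits.AnomalousDissipation.AnomalousDissipation.Theorems.QuarticGate.Negative.LevelCeiling
import Literature.Analysis.FluidPDE.BeltramiWavesCurl
import Literature.Analysis.FunctionSpaces.TorusAxisAverageCalculus

/-!
# Line `passive-third-component` for crux `MomentParity.QuarticGate` (stmt-AnomalousDissipation-11464)
# — planner's CHECKED SKELETON (crux-plan, round 1; triage r1-2 pass, r1-3 pass)

Idea card `Cruxes/QuarticGate/Ideas/passive-third-component.md` (crux-ideate r1, ideator 2); line card
`Cruxes/QuarticGate/Lines/passive-third-component.md`.

THE LINE. Decide the crux inside the INVARIANT SUBSYSTEM `W_N ⊂ V_N` of level-`N` fields carried by the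
plane `k₃ = 0` (fields `u(x₁,x₂) = (v₁,v₂,w)`), with an `x₃`-invariant force `f = (g₁,g₂,h)(x₁,x₂)`:
Galerkin NS on `W_N` is the disc truncation of {2-D Navier–Stokes for `v`} ⊕ {advection–diffusion of the
passively transported third component `w` with steady source `h`}. `W_N` is invariant (`f`, `Δu`,
`B_N(u,u)` stay in `W_N`), so every level-`N` row of a `W_N`-carried law equals the corresponding row of
the subsystem against the `x₃`-averaged test (`stub_rowClosure`, K3 — the card's first lemma, triaged
TRUE twice). Inside `W_N` the route's parity criterion localises loudness: the planar velocity has the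
definite quadratic Casimir `Z_v` (enstrophy) and is quiet (support item `PlanarCubicQuiet`, TRUE) — the
design lets it be quiet — while the transported component's only quadratic Casimir is its variance `W`,
whose row `ν∫‖∇w‖² dμ = ∫(h,w) dμ` is the loudness budget itself. The recession machinery of the picked
line `recession-cone` (S1 sign lemma, S3 defect certificate, S4 far-atom surgery, S5 order-3 surgery)
restricts verbatim to `W_N ≅ ℝⁿ'` (Liouville holds for the truncated 2½-D Euler field, energy is
conserved, Fialkow–Nie is a statement about `ℝⁿ'`): stubs `stub_signLemmaW`, `stub_defectCertificateW`,
`stub_surgeryW`, `stub_order3SurgeryW` below are S1/S3/S4/S5 with "level-`N`" replaced by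
"level-`N` AND planar-carried" and "band test" by "planar band test", and with FOUR quadratic Casimir
rows (`E`, `H = 2X`, `W`, `Z_v`) instead of two. What the line REPLACES: S6 (Kolmogorov + correlated
Taylor pair, 3-D Reynolds-stress design) by K1 `stub_planarDesign` (planar two-shell profile + low-mode
planar/scalar cross-covariance carrying the flux `ε`, scalar variance on a shell `K_w(ν) ≍ ν^{-1/2}`
carrying `ν E‖∇w‖²`; all rows of order `≤ 2`), and S2 (3-D ball Casimir classification, conjectural,
numerics only) by K2 `stub_discCasimirs` (2½-D disc classification: quadratic `= span{E_v,Z_v,W,X}`,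
no cubic — scalar-amplitude per-triad linear algebra, CONFIRMED EXACTLY by the triagers' mod-p rank
computations at every disc `5 ≤ |k|² ≤ 25`, kit j011826 / j011804 / j011810).

COMPOSITION `QuarticGate_of` (kernel-checked, no `sorry` of its own): `f, E, ε, ν₀` from K1,
`ν_j := ν₀/(j+2)`; at each `j`: K1 gives `N₀(ν_j)`; K2's frequently-many clean levels meet `N ≥ N₀`
(`Frequently.and_eventually`); at such `N`: K1's loud planar order-2 design `μ₀` → S5W (fed
QuadRigidity_W) Slater-on-`W_N` 3-stationary `μ₁`, same energy/dissipation → S3W (fed S1W and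
NoCubicCasimir_W) defect certificate → S4W 4-stationary against PLANAR band tests, same
energy/dissipation → K3 row closure: 4-stationary against ALL band tests (`IsPolyStationary ν f N 4 μ`)
→ `quarticGate_iff`.

VOCABULARY. `IsLevel / IsBandTest / polyGrad / IsPolyStationary / IsQuarticWitness / quarticGate_iff` are
the IN-TREE named clauses of the crux (`Theorems/QuarticGate/Negative/LevelCeiling.lean`, definitional,
`quarticGate_iff` by `Iff.rfl`; the lead's support files use them). The two planar clauses are INLINED
(Fourier form, no local definitions, so every stub can be landed verbatim as a `Theorems/…` file):
planar-carried field `u ∈ H`: `∀ k, k 2 ≠ 0 → 𝓕(u)(k) = 0`; planar (x₃-invariant) force/test `g`: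
`∀ k, k 2 ≠ 0 → 𝓕(g)(k) = 0` (for smooth `g` ⟺ invariance under the translations `x ↦ x + s e₃`,
`Torus.mFourierCoeff_eq_zero_of_forall_add_single` / `Torus.realTrigPoly_add_single`). Casimir-row test
fields at `u`: energy `P_N u` (`Torus.fourierTruncate`), helicity `curl P_N u` (`BDSV.curl`; on `W_N`
the helicity is `2X = 2∫ζw`), scalar variance `(0,0,(P_N u)₃)` (`Torus.planarEmbed (0, · 2)`), planar
enstrophy `Δ(P_N u)_h` (`Torus.laplacian` of `Torus.planarEmbed (Torus.planarProjE ·, 0)`); on planar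
level-`N` fields these four are again planar level-`N` fields and span the gradients of
`{E_v, Z_v, W, X}`.

DISPROOF USED (`Cruxes/QuarticGate/Disproof.lean`, cdisprove g2 cycle 2, + landed
`Theorems/QuarticGate/Negative/{LevelCeiling,EnergyRow,Laminar}.lean`): (A) `not_quarticGateBoundedLevel` /
`IsQuarticWitness.eps_le` — honoured by K1: `N₀(ν) = K_w(ν) + 2 → ∞`, scalar gradients on the shell carry
`ε` (`eGradNormSq` counts all three components); (B) `quarticGateWithoutEpsPos_holds` — K1 has
`ε = (h, w̄) > 0` by design; (C) `energy_row_of_polyStationary` / `IsQuarticWitness.eps_le_force` — the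
organising identity of K1: `ν∫‖∇u‖² = (g,V) + (h,w̄) = O(ν) + ε`, `E ≥ (ε/‖f‖₂)²` respected
(`E = 2, ε = 1/4, ‖h‖₂ ≍ 1`); (D)/(F) energy ceiling and `ν_j → 0` kept; (G) the only conjectural stub
of the picked line (S2) is REPLACED by K2, whose 2½-D content is certified by exact computation at the
typed levels `N = 3, 4, 5`; (H) `not_noCubicCasimir_one` / `not_quadRigidity_one` — K2 is stated `∃ᶠ N`
(levels `N ≤ 2` have the small-disc accidents `ζ_(±1,±1)`, `ζ_(±2,0)`; harmless). No `_false_without_`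
theorem names a hypothesis this line drops; no stub is an instance of a landed Negative lemma (the laminar
family of `Negative/Laminar.lean` is a Dirac at a steady state — K1's law has nondegenerate covariance).
-/

namespace Summit.AnomalousDissipation.AnomalousDissipation.Cruxes.QuarticGate.PassiveThirdComponent

open MeasureTheory Filter
open Literature.Analysis.FunctionSpaces Literature.Analysis.FluidPDE
open Summit.AnomalousDissipation.AnomalousDissipation.Theses.MomentParity
open Summit.AnomalousDissipation.AnomalousDissipation.Theorems.QuarticGate.Negative

set_option linter.dupNamespace false

/-! ## The stubs (K3, K2, S1W, S3W, S4W, S5W, K1) -/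

/-- **K3 — SUBSYSTEM ROW CLOSURE (the card's first lemma; triage r1-2 and r1-3: TRUE).**
For an `x₃`-invariant smooth force `f` and a law `μ` carried by planar (`k₃ = 0`) level-`N` fields,
`d`-stationarity against the PLANAR polynomial cylindrical band tests already gives `d`-stationarity
against ALL level-`N` band tests (`IsPolyStationary ν f N d μ`).
Why true: for planar `u` and a band test `gᵢ`, `(u, gᵢ) = (u, P₀gᵢ)` with `P₀ = Torus.axisAvg 2` the
`x₃`-average (`Torus.integral_inner_eq_integral_inner_axisAvg`), so `∇p(u) = Σᵢ ∂ᵢP((u,P₀g)) gᵢ`; and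
`⟨F(u), Σᵢ cᵢ gᵢ⟩ = ⟨F(u), Σᵢ cᵢ P₀gᵢ⟩` term by term (`f`, `u`, `u ⊗ u` are `x₃`-invariant; `Δ` and `∇`
commute with `P₀`: `partialDeriv_axisAvg`); `P₀gᵢ` is again a smooth solenoidal mean-zero band test
(`IsSmooth.axisAvg`, `IsDivFree.axisAvg`, Fourier support `k₃ = 0` ∩ band) and planar; so the two row
integrands agree `μ`-a.e. and the hypothesis applies with the same `P`. (Smooth planar fields ARE
translation invariant: `mFourierCoeff_comp_add_single` + Fourier uniqueness on `L²`, or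
`realTrigPoly_add_single` for band-limited ones.) Size M. -/
theorem stub_rowClosure :
    ∀ (ν : ℝ) (f : UnitAddTorus (Fin 3) → EuclideanSpace ℝ (Fin 3)) (N d : ℕ) (μ : Measure (Torus.energySpace (Fin 3))),
    Torus.IsSmooth f → (∀ k : Fin 3 → ℤ, k 2 ≠ 0 → UnitAddTorus.mFourierCoeff (EuclideanSpace.complexify ∘ (f)) k = 0) →
    IsProbabilityMeasure μ → (∀ᵐ u ∂μ, IsLevel N u ∧ (∀ k : Fin 3 → ℤ, k 2 ≠ 0 → UnitAddTorus.mFourierCoeff (EuclideanSpace.complexify ∘ (u.1 : UnitAddTorus (Fin 3) → EuclideanSpace ℝ (Fin 3))) k = 0)) →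
    Integrable (fun u : Torus.energySpace (Fin 3) => ‖u‖ ^ d) μ →
    (∀ (m : ℕ) (g : Fin m → UnitAddTorus (Fin 3) → EuclideanSpace ℝ (Fin 3)) (P : MvPolynomial (Fin m) ℝ),
      (∀ i, (IsBandTest N (g i) ∧ (∀ k : Fin 3 → ℤ, k 2 ≠ 0 → UnitAddTorus.mFourierCoeff (EuclideanSpace.complexify ∘ (g i)) k = 0))) → P.totalDegree + 1 ≤ d →
      Integrable (fun u : Torus.energySpace (Fin 3) => Torus.nsGeneratorPairing ν f u (polyGrad g P u)) μ ∧
      ∫ u : Torus.energySpace (Fin 3), Torus.nsGeneratorPairing ν f u (polyGrad g P u) ∂μ = 0) →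
    IsPolyStationary ν f N d μ := by
  sorry

/-- **K2 — CASIMIR CLASSIFICATION OF THE 2½-D DISC SUBSYSTEM at infinitely many levels (replaces S2).**
For frequently many `N`: (i) `NoCubicCasimir_W N` — a homogeneous CUBIC polynomial observable with
planar band tests whose Euler derivative `{p,B_N}` vanishes on planar level-`N` fields vanishes there
(no cubic invariant of the disc truncation of 2-D Euler ⊕ passive scalar); (ii) `QuadRigidity_W N` —
every homogeneous QUADRATIC such invariant has, on planar level-`N` fields, gradient
`α P_N u + β curl P_N u + γ (0,0,(P_N u)₃) + δ Δ(P_N u)_h`, i.e. is a combination of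
`E = |u|², H = 2∫ζw, W = ∫w², Z_v = ‖∇v‖²` (equivalently of `E_v, Z_v, W, X`).
Why plausibly true: in vorticity–scalar amplitudes `(ζ_k, w_k)`, `k` in the disc `0 < |k|² ≤ N²`,
`ζ̇_k = −½Σ_{p+q=k}(p×q)(|p|⁻²−|q|⁻²)ζ_pζ_q`, `ẇ_k = −Σ_{p+q=k}(p×q)|p|⁻²ζ_p w_q`; translation
covariance grades invariants by momentum `θ ∈ ℤ²`; per non-isosceles triad the `ζζ`-kernel is the
classical 2-dimensional `span{(1,1,1),(|a|⁻²,|b|⁻²,|c|⁻²)}`, the `ww`-kernel forces `t_b = t_c`, the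
`ζw`-kernel is `(1,1,1)`; two legs of distinct norm determine the third and the moves `c = ±a ± b` inside
the disc reach every mode from `(1,0),(1,1)` once `|k|² = 5` is present — the card's propagation proof
(triage r1-2 sharpening (1): ALL sectors `θ`, off-centre forms included). EXACT EVIDENCE (two
independent mod-p rank computations, TRIAGE-r1-2 App. B and TRIAGE-r1-3 §numbers, kit j011804 /
j011810 / j011826): at every disc `5 ≤ |k|² ≤ 25` (typed levels `N = 3, 4, 5`) quadratic nullity
`(ζζ,ζw,ww) = (2,1,1)` at `θ = 0` and `0` in all 22 off-centre sectors, cubic nullity `0`; accidents only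
at `|k|² ≤ 4` (`N ≤ 2`: linear Casimirs `ζ_(±1,±1)`, `ζ_(±2,0)`), as predicted. Expected truth: for
EVERY `N ≥ 3` (triage r1-3), which implies this `∃ᶠ` form; `N = 1, 2` are false-but-harmless
(Disproof §H). Why it might fail: only through accidental invariants of the disc persisting at ALL large
`N`. Size M–L (combinatorial linear algebra over `Torus.freqBall ∩ {k₃ = 0}`; the velocity/vorticity
dictionary on `W_N` via `Torus.realTrigPoly`, `convectionCoeff`). -/
theorem stub_discCasimirs :
    ∃ᶠ N in atTop,
    (∀ (m : ℕ) (g : Fin m → UnitAddTorus (Fin 3) → EuclideanSpace ℝ (Fin 3)) (P : MvPolynomial (Fin m) ℝ),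
      (∀ i, (IsBandTest N (g i) ∧ (∀ k : Fin 3 → ℤ, k 2 ≠ 0 → UnitAddTorus.mFourierCoeff (EuclideanSpace.complexify ∘ (g i)) k = 0))) → P.IsHomogeneous 3 →
      (∀ u : Torus.energySpace (Fin 3), IsLevel N u → (∀ k : Fin 3 → ℤ, k 2 ≠ 0 → UnitAddTorus.mFourierCoeff (EuclideanSpace.complexify ∘ (u.1 : UnitAddTorus (Fin 3) → EuclideanSpace ℝ (Fin 3))) k = 0) → Torus.nsGeneratorPairing (d := Fin 3) 0 0 u (polyGrad g P u) = 0) →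
      ∀ u : Torus.energySpace (Fin 3), IsLevel N u → (∀ k : Fin 3 → ℤ, k 2 ≠ 0 → UnitAddTorus.mFourierCoeff (EuclideanSpace.complexify ∘ (u.1 : UnitAddTorus (Fin 3) → EuclideanSpace ℝ (Fin 3))) k = 0) → MvPolynomial.eval (fun j => Torus.pairing u.1 (g j)) P = 0) ∧
    (∀ (m : ℕ) (g : Fin m → UnitAddTorus (Fin 3) → EuclideanSpace ℝ (Fin 3)) (P : MvPolynomial (Fin m) ℝ),
      (∀ i, (IsBandTest N (g i) ∧ (∀ k : Fin 3 → ℤ, k 2 ≠ 0 → UnitAddTorus.mFourierCoeff (EuclideanSpace.complexify ∘ (g i)) k = 0))) → P.IsHomogeneous 2 →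
      (∀ u : Torus.energySpace (Fin 3), IsLevel N u → (∀ k : Fin 3 → ℤ, k 2 ≠ 0 → UnitAddTorus.mFourierCoeff (EuclideanSpace.complexify ∘ (u.1 : UnitAddTorus (Fin 3) → EuclideanSpace ℝ (Fin 3))) k = 0) → Torus.nsGeneratorPairing (d := Fin 3) 0 0 u (polyGrad g P u) = 0) →
      ∃ α β γ δ : ℝ, ∀ u : Torus.energySpace (Fin 3), IsLevel N u → (∀ k : Fin 3 → ℤ, k 2 ≠ 0 → UnitAddTorus.mFourierCoeff (EuclideanSpace.complexify ∘ (u.1 : UnitAddTorus (Fin 3) → EuclideanSpace ℝ (Fin 3))) k = 0) → ∀ x,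
        polyGrad g P u x =
          α • Torus.fourierTruncate N (u.1 : UnitAddTorus (Fin 3) → EuclideanSpace ℝ (Fin 3)) x + β • BDSV.curl (Torus.fourierTruncate N (u.1 : UnitAddTorus (Fin 3) → EuclideanSpace ℝ (Fin 3))) x +
          γ • Torus.planarEmbed ((0 : EuclideanSpace ℝ (Fin 2)), (Torus.fourierTruncate N (u.1 : UnitAddTorus (Fin 3) → EuclideanSpace ℝ (Fin 3)) x) 2) +
          δ • Torus.laplacian (fun y => Torus.planarEmbed (Torus.planarProjE (Torus.fourierTruncate N (u.1 : UnitAddTorus (Fin 3) → EuclideanSpace ℝ (Fin 3)) y), (0 : ℝ))) x) := by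
  sorry

/-- **S1W — SIGN LEMMA ON THE SUBSYSTEM (S1 of `recession-cone` restricted to `W_N`).**
A polynomial cylindrical observable with planar band tests whose Euler derivative
`{p,B_N}(u) = nsGeneratorPairing 0 0 u (∇p(u)) = −b(u,u,∇p(u))` is `≥ 0` at every planar level-`N`
field vanishes identically there.
Why true (same proof as S1, one invariant subspace down): in frame coordinates of `W_N` (planar frame
modes `k₃ = 0`: one solenoidal horizontal polarisation `k^⊥` and the vertical one `e₃` per wavevector)
the restricted Galerkin–Euler field `Ẽ` is divergence free — each diagonal entry `∂F_a/∂c_a =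
−(B(e_a,u),e_a) − (B(u,e_a),e_a) = 0` vanishes INDIVIDUALLY (`(e_a·∇)e_a = 0` for `a ⊥ k`, and
`(B(u,e),e) = 0`), so Liouville survives restriction to any set of frame modes — and `Ẽ(c)·c = 0`
(energy); hence `∫ ψ(|c|²) {p,B_N} dc = ∫ div(ψ p̃ Ẽ) = 0` for a radial bump and the continuous
nonnegative integrand vanishes (the lead's landed `signLemma_calculus`, Theorems/…SignLemmaCalculus, is
dimension-free). Equivalently: the Gaussian `exp(−β E)` on `W_N` is invariant for the truncated 2½-D
Euler dynamics (triage r1-3 (iv)). Degenerate levels (`N ≤ 2`, few triads) satisfy it trivially or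
honestly. Size M. -/
theorem stub_signLemmaW :
    ∀ (N m : ℕ) (g : Fin m → UnitAddTorus (Fin 3) → EuclideanSpace ℝ (Fin 3)) (P : MvPolynomial (Fin m) ℝ),
      (∀ i, (IsBandTest N (g i) ∧ (∀ k : Fin 3 → ℤ, k 2 ≠ 0 → UnitAddTorus.mFourierCoeff (EuclideanSpace.complexify ∘ (g i)) k = 0))) →
      (∀ u : Torus.energySpace (Fin 3), IsLevel N u → (∀ k : Fin 3 → ℤ, k 2 ≠ 0 → UnitAddTorus.mFourierCoeff (EuclideanSpace.complexify ∘ (u.1 : UnitAddTorus (Fin 3) → EuclideanSpace ℝ (Fin 3))) k = 0) → 0 ≤ Torus.nsGeneratorPairing (d := Fin 3) 0 0 u (polyGrad g P u)) →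
      ∀ u : Torus.energySpace (Fin 3), IsLevel N u → (∀ k : Fin 3 → ℤ, k 2 ≠ 0 → UnitAddTorus.mFourierCoeff (EuclideanSpace.complexify ∘ (u.1 : UnitAddTorus (Fin 3) → EuclideanSpace ℝ (Fin 3))) k = 0) → Torus.nsGeneratorPairing (d := Fin 3) 0 0 u (polyGrad g P u) = 0 := by
  sorry

/-- **S3W — DEFECT CERTIFICATE ON THE SUBSYSTEM (S3 of `recession-cone` restricted to `W_N`; the
recession-cone lever).** Assume the subsystem sign lemma (S1W, as a hypothesis) and `NoCubicCasimir_W N`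
(K2 (i)). Then for every viscosity, smooth force and `W_N`-carried probability law `μ` with finite fourth
moments there are finitely many planar level-`N` fields `vₗ` and weights `cₗ ≥ 0` with
`row_μ(p₃) + Σₗ cₗ {p₃,B_N}(vₗ) = 0` for every homogeneous cubic PLANAR test `p₃`.
Why true: `W :=` homogeneous cubic polynomial functions on `W_N` (finite-dimensional); the row of a
planar cubic test depends on `(g,P)` only through `p₃|_{W_N}` (for planar level-`N` `u`, `∇p₃(u) =
Σᵢ∂ᵢP gᵢ` is the `H`-gradient, lies in `span gᵢ ⊂ W_N`, hence is the `W_N`-gradient of `p₃|_{W_N}`;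
`(f,·)`, `ν(u,Δ·)`, `∫(u⊗u):∇·` are then functions of that gradient; `f ∈ L²` + `∫‖u‖⁴ < ∞` give
integrability and linearity), so `ψ := −row_μ|_W ∈ W*` is well defined; `C := cone{ev_v : v ∈ W_N}`,
`ev_v(p₃) = {p₃,B_N}(v)`, is a convex cone whose dual is `{0}` by the two hypotheses, and a convex cone
with trivial dual in finite dimension is everything (the lead's landed abstract cone lemma
`exists_conic_certificate`, Theorems/MomentParityQuarticGateDefectCone, is space-agnostic). `f` need not
be planar here. Size M. -/
theorem stub_defectCertificateW :
    (∀ (N m : ℕ) (g : Fin m → UnitAddTorus (Fin 3) → EuclideanSpace ℝ (Fin 3)) (P : MvPolynomial (Fin m) ℝ),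
      (∀ i, (IsBandTest N (g i) ∧ (∀ k : Fin 3 → ℤ, k 2 ≠ 0 → UnitAddTorus.mFourierCoeff (EuclideanSpace.complexify ∘ (g i)) k = 0))) →
      (∀ u : Torus.energySpace (Fin 3), IsLevel N u → (∀ k : Fin 3 → ℤ, k 2 ≠ 0 → UnitAddTorus.mFourierCoeff (EuclideanSpace.complexify ∘ (u.1 : UnitAddTorus (Fin 3) → EuclideanSpace ℝ (Fin 3))) k = 0) → 0 ≤ Torus.nsGeneratorPairing (d := Fin 3) 0 0 u (polyGrad g P u)) →
      ∀ u : Torus.energySpace (Fin 3), IsLevel N u → (∀ k : Fin 3 → ℤ, k 2 ≠ 0 → UnitAddTorus.mFourierCoeff (EuclideanSpace.complexify ∘ (u.1 : UnitAddTorus (Fin 3) → EuclideanSpace ℝ (Fin 3))) k = 0) → Torus.nsGeneratorPairing (d := Fin 3) 0 0 u (polyGrad g P u) = 0) →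
    ∀ N : ℕ, (∀ (m : ℕ) (g : Fin m → UnitAddTorus (Fin 3) → EuclideanSpace ℝ (Fin 3)) (P : MvPolynomial (Fin m) ℝ),
      (∀ i, (IsBandTest N (g i) ∧ (∀ k : Fin 3 → ℤ, k 2 ≠ 0 → UnitAddTorus.mFourierCoeff (EuclideanSpace.complexify ∘ (g i)) k = 0))) → P.IsHomogeneous 3 →
      (∀ u : Torus.energySpace (Fin 3), IsLevel N u → (∀ k : Fin 3 → ℤ, k 2 ≠ 0 → UnitAddTorus.mFourierCoeff (EuclideanSpace.complexify ∘ (u.1 : UnitAddTorus (Fin 3) → EuclideanSpace ℝ (Fin 3))) k = 0) → Torus.nsGeneratorPairing (d := Fin 3) 0 0 u (polyGrad g P u) = 0) →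
      ∀ u : Torus.energySpace (Fin 3), IsLevel N u → (∀ k : Fin 3 → ℤ, k 2 ≠ 0 → UnitAddTorus.mFourierCoeff (EuclideanSpace.complexify ∘ (u.1 : UnitAddTorus (Fin 3) → EuclideanSpace ℝ (Fin 3))) k = 0) → MvPolynomial.eval (fun j => Torus.pairing u.1 (g j)) P = 0) →
    ∀ (ν : ℝ) (f : UnitAddTorus (Fin 3) → EuclideanSpace ℝ (Fin 3)), Torus.IsSmooth f →
    ∀ μ : Measure (Torus.energySpace (Fin 3)), IsProbabilityMeasure μ → (∀ᵐ u ∂μ, IsLevel N u ∧ (∀ k : Fin 3 → ℤ, k 2 ≠ 0 → UnitAddTorus.mFourierCoeff (EuclideanSpace.complexify ∘ (u.1 : UnitAddTorus (Fin 3) → EuclideanSpace ℝ (Fin 3))) k = 0)) → Integrable (fun u : Torus.energySpace (Fin 3) => ‖u‖ ^ 4) μ →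
      ∃ (M : ℕ) (v : Fin M → Torus.energySpace (Fin 3)) (c : Fin M → ℝ),
      ((∀ l, IsLevel N (v l) ∧ (∀ k : Fin 3 → ℤ, k 2 ≠ 0 → UnitAddTorus.mFourierCoeff (EuclideanSpace.complexify ∘ ((v l).1 : UnitAddTorus (Fin 3) → EuclideanSpace ℝ (Fin 3))) k = 0)) ∧ (∀ l, 0 ≤ c l) ∧
      ∀ (m : ℕ) (g : Fin m → UnitAddTorus (Fin 3) → EuclideanSpace ℝ (Fin 3)) (P : MvPolynomial (Fin m) ℝ),
      (∀ i, (IsBandTest N (g i) ∧ (∀ k : Fin 3 → ℤ, k 2 ≠ 0 → UnitAddTorus.mFourierCoeff (EuclideanSpace.complexify ∘ (g i)) k = 0))) → P.IsHomogeneous 3 →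
      ∫ u : Torus.energySpace (Fin 3), Torus.nsGeneratorPairing ν f u (polyGrad g P u) ∂μ +
        ∑ l, c l * Torus.nsGeneratorPairing (d := Fin 3) 0 0 (v l) (polyGrad g P (v l)) = 0) := by
  sorry

/-- **S4W — EXACT FAR-ATOM SURGERY AT ORDER 4 ON THE SUBSYSTEM (S4 of `recession-cone` restricted to
`W_N`).** A `W_N`-carried probability law `μ₀` with finite fourth moments and STRICTLY positive degree-4
Riesz functional on `W_N` (Slater on the subsystem: every polynomial of degree `≤ 4` in planar band tests
that is `≥ 0` and not identically `0` on planar level-`N` fields has positive mean), 3-stationary against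
planar band tests at `(ν,f,N)`, plus a defect certificate `(vₗ, cₗ)` of planar level-`N` fields for the
homogeneous cubic planar tests ⟹ a `W_N`-carried probability law with finite fourth moments,
4-STATIONARY against planar band tests, with the same mean energy and dissipation.
Why true: verbatim S4 inside `W_N ≅ ℝⁿ'` (coordinates in an orthonormal PLANAR band basis, the planar
sub-family of the lead's `exists_bandBasis`): `w := R⁻⁴Σcₗ`, `μ := (1−w)μ₀' + Σₗ cₗR⁻⁴·½(δ_{Rvₗ}+δ_{−Rvₗ})`
with `μ₀'` a law on `W_N` of degree-4 moments `(1, M₁, M₂ − R⁻²Σcₗvₗvₗᵀ, M₃, M₄)(μ₀)/(1−w)` — strict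
positivity is open (`exists_isStrictlyKPositive_nhds`, landed), so Fialkow–Nie
(`Literature.MeasureTheory.Moments.FialkowNie2010_thm_1_3_holds`, PROVED; `exists_measure_of_strictlyKPositive`,
landed) realises it for `R ≫ 1`, pushed forward along the synthesis map `ℝⁿ' → W_N ⊂ H`
(`exists_level_of_coords` restricted to planar coordinates keeps `k₃ = 0`); rows of planar tests of degree
`≤ 2` are unchanged (`= 0`), cubic rows are shifted by the certificate (`= 0`), energy and dissipation are
quadratic (`exists_gradNormSq_poly`), unchanged. Size L. -/
theorem stub_surgeryW :
    ∀ (ν : ℝ) (f : UnitAddTorus (Fin 3) → EuclideanSpace ℝ (Fin 3)) (N : ℕ) (μ₀ : Measure (Torus.energySpace (Fin 3))),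
    Torus.IsSmooth f → IsProbabilityMeasure μ₀ → (∀ᵐ u ∂μ₀, IsLevel N u ∧ (∀ k : Fin 3 → ℤ, k 2 ≠ 0 → UnitAddTorus.mFourierCoeff (EuclideanSpace.complexify ∘ (u.1 : UnitAddTorus (Fin 3) → EuclideanSpace ℝ (Fin 3))) k = 0)) →
    Integrable (fun u : Torus.energySpace (Fin 3) => ‖u‖ ^ 4) μ₀ →
    (∀ (m : ℕ) (g : Fin m → UnitAddTorus (Fin 3) → EuclideanSpace ℝ (Fin 3)) (P : MvPolynomial (Fin m) ℝ),
      (∀ i, (IsBandTest N (g i) ∧ (∀ k : Fin 3 → ℤ, k 2 ≠ 0 → UnitAddTorus.mFourierCoeff (EuclideanSpace.complexify ∘ (g i)) k = 0))) → P.totalDegree ≤ 4 →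
      (∀ u : Torus.energySpace (Fin 3), IsLevel N u → (∀ k : Fin 3 → ℤ, k 2 ≠ 0 → UnitAddTorus.mFourierCoeff (EuclideanSpace.complexify ∘ (u.1 : UnitAddTorus (Fin 3) → EuclideanSpace ℝ (Fin 3))) k = 0) → 0 ≤ MvPolynomial.eval (fun j => Torus.pairing u.1 (g j)) P) →
      (∃ u : Torus.energySpace (Fin 3), IsLevel N u ∧ (∀ k : Fin 3 → ℤ, k 2 ≠ 0 → UnitAddTorus.mFourierCoeff (EuclideanSpace.complexify ∘ (u.1 : UnitAddTorus (Fin 3) → EuclideanSpace ℝ (Fin 3))) k = 0) ∧ MvPolynomial.eval (fun j => Torus.pairing u.1 (g j)) P ≠ 0) →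
      0 < ∫ u : Torus.energySpace (Fin 3), MvPolynomial.eval (fun j => Torus.pairing u.1 (g j)) P ∂μ₀) →
    (∀ (m : ℕ) (g : Fin m → UnitAddTorus (Fin 3) → EuclideanSpace ℝ (Fin 3)) (P : MvPolynomial (Fin m) ℝ),
      (∀ i, (IsBandTest N (g i) ∧ (∀ k : Fin 3 → ℤ, k 2 ≠ 0 → UnitAddTorus.mFourierCoeff (EuclideanSpace.complexify ∘ (g i)) k = 0))) → P.totalDegree + 1 ≤ 3 →
      Integrable (fun u : Torus.energySpace (Fin 3) => Torus.nsGeneratorPairing ν f u (polyGrad g P u)) μ₀ ∧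
      ∫ u : Torus.energySpace (Fin 3), Torus.nsGeneratorPairing ν f u (polyGrad g P u) ∂μ₀ = 0) →
    ∀ (M : ℕ) (v : Fin M → Torus.energySpace (Fin 3)) (c : Fin M → ℝ),
    ((∀ l, IsLevel N (v l) ∧ (∀ k : Fin 3 → ℤ, k 2 ≠ 0 → UnitAddTorus.mFourierCoeff (EuclideanSpace.complexify ∘ ((v l).1 : UnitAddTorus (Fin 3) → EuclideanSpace ℝ (Fin 3))) k = 0)) ∧ (∀ l, 0 ≤ c l) ∧
      ∀ (m : ℕ) (g : Fin m → UnitAddTorus (Fin 3) → EuclideanSpace ℝ (Fin 3)) (P : MvPolynomial (Fin m) ℝ),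
      (∀ i, (IsBandTest N (g i) ∧ (∀ k : Fin 3 → ℤ, k 2 ≠ 0 → UnitAddTorus.mFourierCoeff (EuclideanSpace.complexify ∘ (g i)) k = 0))) → P.IsHomogeneous 3 →
      ∫ u : Torus.energySpace (Fin 3), Torus.nsGeneratorPairing ν f u (polyGrad g P u) ∂μ₀ +
        ∑ l, c l * Torus.nsGeneratorPairing (d := Fin 3) 0 0 (v l) (polyGrad g P (v l)) = 0) →
    ∃ μ : Measure (Torus.energySpace (Fin 3)), IsProbabilityMeasure μ ∧ (∀ᵐ u ∂μ, IsLevel N u ∧ (∀ k : Fin 3 → ℤ, k 2 ≠ 0 → UnitAddTorus.mFourierCoeff (EuclideanSpace.complexify ∘ (u.1 : UnitAddTorus (Fin 3) → EuclideanSpace ℝ (Fin 3))) k = 0)) ∧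
      Integrable (fun u : Torus.energySpace (Fin 3) => ‖u‖ ^ 4) μ ∧
      (∀ (m : ℕ) (g : Fin m → UnitAddTorus (Fin 3) → EuclideanSpace ℝ (Fin 3)) (P : MvPolynomial (Fin m) ℝ),
      (∀ i, (IsBandTest N (g i) ∧ (∀ k : Fin 3 → ℤ, k 2 ≠ 0 → UnitAddTorus.mFourierCoeff (EuclideanSpace.complexify ∘ (g i)) k = 0))) → P.totalDegree + 1 ≤ 4 →
      Integrable (fun u : Torus.energySpace (Fin 3) => Torus.nsGeneratorPairing ν f u (polyGrad g P u)) μ ∧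
      ∫ u : Torus.energySpace (Fin 3), Torus.nsGeneratorPairing ν f u (polyGrad g P u) ∂μ = 0) ∧
      Torus.ensembleEnergy μ = Torus.ensembleEnergy μ₀ ∧
      Torus.ensembleDissipation ν μ = Torus.ensembleDissipation ν μ₀ := by
  sorry

/-- **S5W — ORDER-3 SURGERY + SLATER UPGRADE ON THE SUBSYSTEM (S5 of `recession-cone` restricted to
`W_N`, with FOUR Casimir rows).** A `W_N`-carried probability law `μ₀` with bounded support and
NONDEGENERATE covariance on `W_N`, whose LINEAR rows against planar band tests vanish and whose four
quadratic CASIMIR rows vanish — energy (`∇E = 2P_N u`), helicity (`∇H = 2 curl P_N u`; on `W_N`,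
`H = 2X = 2∫ζw`), scalar variance (`∇W = 2(0,0,u₃)`), planar enstrophy (`∇Z_v = −2Δu_h`) — at a level
where `QuadRigidity_W N` (K2 (ii)) holds ⟹ a `W_N`-carried law `μ₁` with finite fourth moments, Slater
on `W_N` at degree 4, 3-STATIONARY against planar band tests, same mean energy and dissipation.
Why true (the recession lever one order down, inside `W_N`): the row of a quadratic planar test is affine
in `(M₁,M₂,M₃)|_{W_N}` and sees `M₃` only through the cubic form `{p₂,B_N}|_{W_N}`; the defect functional
`p₂ ↦ row_{μ₀}(p₂)` vanishes on `ker(p₂ ↦ {p₂,B_N}|_{W_N})` = quadratic subsystem Casimirs, whose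
gradients are by QuadRigidity_W combinations of the four displayed fields, so their rows are
`α·(energy row) + β·(helicity row) + γ·(variance row) + δ·(enstrophy row) = 0`; hence the defect lies in
the range of the adjoint and is killed by a shift `S` of the third moments on `W_N` (the lead's
`exists_eq_sum_mul_of_forall_sum_eq_zero` / Kernel step with four rows instead of two); FATTEN first
(`exists_isStrictlyKPositive_eq_of_degree_le_two`, landed: nondegenerate covariance ⇒ a strictly positive
functional with the same moments of order `≤ 2`), inflate `M₄` (`exists_forall_le_isStrictlyKPositive_shift`,
landed), realise by Fialkow–Nie on planar coordinates and push forward into `W_N`. Rows of degree-`≤ 1`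
tests, energy and dissipation depend on `M_{≤2}` only — unchanged. Size L. -/
theorem stub_order3SurgeryW :
    ∀ (ν : ℝ) (f : UnitAddTorus (Fin 3) → EuclideanSpace ℝ (Fin 3)) (N : ℕ) (μ₀ : Measure (Torus.energySpace (Fin 3))),
    Torus.IsSmooth f → IsProbabilityMeasure μ₀ → (∀ᵐ u ∂μ₀, IsLevel N u ∧ (∀ k : Fin 3 → ℤ, k 2 ≠ 0 → UnitAddTorus.mFourierCoeff (EuclideanSpace.complexify ∘ (u.1 : UnitAddTorus (Fin 3) → EuclideanSpace ℝ (Fin 3))) k = 0)) →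
    (∃ R : ℝ, ∀ᵐ u ∂μ₀, ‖u‖ ≤ R) →
    (∀ g : UnitAddTorus (Fin 3) → EuclideanSpace ℝ (Fin 3), (IsBandTest N (g) ∧ (∀ k : Fin 3 → ℤ, k 2 ≠ 0 → UnitAddTorus.mFourierCoeff (EuclideanSpace.complexify ∘ (g)) k = 0)) →
      (∃ u : Torus.energySpace (Fin 3), IsLevel N u ∧ (∀ k : Fin 3 → ℤ, k 2 ≠ 0 → UnitAddTorus.mFourierCoeff (EuclideanSpace.complexify ∘ (u.1 : UnitAddTorus (Fin 3) → EuclideanSpace ℝ (Fin 3))) k = 0) ∧ Torus.pairing u.1 g ≠ 0) →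
      (∫ u : Torus.energySpace (Fin 3), Torus.pairing u.1 g ∂μ₀) ^ 2 < ∫ u : Torus.energySpace (Fin 3), (Torus.pairing u.1 g) ^ 2 ∂μ₀) →
    (∀ g : UnitAddTorus (Fin 3) → EuclideanSpace ℝ (Fin 3), (IsBandTest N (g) ∧ (∀ k : Fin 3 → ℤ, k 2 ≠ 0 → UnitAddTorus.mFourierCoeff (EuclideanSpace.complexify ∘ (g)) k = 0)) →
      Integrable (fun u : Torus.energySpace (Fin 3) => Torus.nsGeneratorPairing ν f u g) μ₀ ∧
      ∫ u : Torus.energySpace (Fin 3), Torus.nsGeneratorPairing ν f u g ∂μ₀ = 0) →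
    (Integrable (fun u : Torus.energySpace (Fin 3) => Torus.nsGeneratorPairing ν f u (Torus.fourierTruncate N (u.1 : UnitAddTorus (Fin 3) → EuclideanSpace ℝ (Fin 3)))) μ₀ ∧
      ∫ u : Torus.energySpace (Fin 3), Torus.nsGeneratorPairing ν f u (Torus.fourierTruncate N (u.1 : UnitAddTorus (Fin 3) → EuclideanSpace ℝ (Fin 3))) ∂μ₀ = 0) →
    (Integrable (fun u : Torus.energySpace (Fin 3) => Torus.nsGeneratorPairing ν f u (BDSV.curl (Torus.fourierTruncate N (u.1 : UnitAddTorus (Fin 3) → EuclideanSpace ℝ (Fin 3))))) μ₀ ∧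
      ∫ u : Torus.energySpace (Fin 3), Torus.nsGeneratorPairing ν f u (BDSV.curl (Torus.fourierTruncate N (u.1 : UnitAddTorus (Fin 3) → EuclideanSpace ℝ (Fin 3)))) ∂μ₀ = 0) →
    (Integrable (fun u : Torus.energySpace (Fin 3) => Torus.nsGeneratorPairing ν f u (fun x => Torus.planarEmbed ((0 : EuclideanSpace ℝ (Fin 2)), (Torus.fourierTruncate N (u.1 : UnitAddTorus (Fin 3) → EuclideanSpace ℝ (Fin 3)) x) 2))) μ₀ ∧
      ∫ u : Torus.energySpace (Fin 3), Torus.nsGeneratorPairing ν f u (fun x => Torus.planarEmbed ((0 : EuclideanSpace ℝ (Fin 2)), (Torus.fourierTruncate N (u.1 : UnitAddTorus (Fin 3) → EuclideanSpace ℝ (Fin 3)) x) 2)) ∂μ₀ = 0) →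
    (Integrable (fun u : Torus.energySpace (Fin 3) => Torus.nsGeneratorPairing ν f u (fun x => Torus.laplacian (fun y => Torus.planarEmbed (Torus.planarProjE (Torus.fourierTruncate N (u.1 : UnitAddTorus (Fin 3) → EuclideanSpace ℝ (Fin 3)) y), (0 : ℝ))) x)) μ₀ ∧
      ∫ u : Torus.energySpace (Fin 3), Torus.nsGeneratorPairing ν f u (fun x => Torus.laplacian (fun y => Torus.planarEmbed (Torus.planarProjE (Torus.fourierTruncate N (u.1 : UnitAddTorus (Fin 3) → EuclideanSpace ℝ (Fin 3)) y), (0 : ℝ))) x) ∂μ₀ = 0) →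
    (∀ (m : ℕ) (g : Fin m → UnitAddTorus (Fin 3) → EuclideanSpace ℝ (Fin 3)) (P : MvPolynomial (Fin m) ℝ),
      (∀ i, (IsBandTest N (g i) ∧ (∀ k : Fin 3 → ℤ, k 2 ≠ 0 → UnitAddTorus.mFourierCoeff (EuclideanSpace.complexify ∘ (g i)) k = 0))) → P.IsHomogeneous 2 →
      (∀ u : Torus.energySpace (Fin 3), IsLevel N u → (∀ k : Fin 3 → ℤ, k 2 ≠ 0 → UnitAddTorus.mFourierCoeff (EuclideanSpace.complexify ∘ (u.1 : UnitAddTorus (Fin 3) → EuclideanSpace ℝ (Fin 3))) k = 0) → Torus.nsGeneratorPairing (d := Fin 3) 0 0 u (polyGrad g P u) = 0) →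
      ∃ α β γ δ : ℝ, ∀ u : Torus.energySpace (Fin 3), IsLevel N u → (∀ k : Fin 3 → ℤ, k 2 ≠ 0 → UnitAddTorus.mFourierCoeff (EuclideanSpace.complexify ∘ (u.1 : UnitAddTorus (Fin 3) → EuclideanSpace ℝ (Fin 3))) k = 0) → ∀ x,
        polyGrad g P u x =
          α • Torus.fourierTruncate N (u.1 : UnitAddTorus (Fin 3) → EuclideanSpace ℝ (Fin 3)) x + β • BDSV.curl (Torus.fourierTruncate N (u.1 : UnitAddTorus (Fin 3) → EuclideanSpace ℝ (Fin 3))) x +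
          γ • Torus.planarEmbed ((0 : EuclideanSpace ℝ (Fin 2)), (Torus.fourierTruncate N (u.1 : UnitAddTorus (Fin 3) → EuclideanSpace ℝ (Fin 3)) x) 2) +
          δ • Torus.laplacian (fun y => Torus.planarEmbed (Torus.planarProjE (Torus.fourierTruncate N (u.1 : UnitAddTorus (Fin 3) → EuclideanSpace ℝ (Fin 3)) y), (0 : ℝ))) x) →
    ∃ μ₁ : Measure (Torus.energySpace (Fin 3)), IsProbabilityMeasure μ₁ ∧ (∀ᵐ u ∂μ₁, IsLevel N u ∧ (∀ k : Fin 3 → ℤ, k 2 ≠ 0 → UnitAddTorus.mFourierCoeff (EuclideanSpace.complexify ∘ (u.1 : UnitAddTorus (Fin 3) → EuclideanSpace ℝ (Fin 3))) k = 0)) ∧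
      Integrable (fun u : Torus.energySpace (Fin 3) => ‖u‖ ^ 4) μ₁ ∧
      (∀ (m : ℕ) (g : Fin m → UnitAddTorus (Fin 3) → EuclideanSpace ℝ (Fin 3)) (P : MvPolynomial (Fin m) ℝ),
      (∀ i, (IsBandTest N (g i) ∧ (∀ k : Fin 3 → ℤ, k 2 ≠ 0 → UnitAddTorus.mFourierCoeff (EuclideanSpace.complexify ∘ (g i)) k = 0))) → P.totalDegree ≤ 4 →
      (∀ u : Torus.energySpace (Fin 3), IsLevel N u → (∀ k : Fin 3 → ℤ, k 2 ≠ 0 → UnitAddTorus.mFourierCoeff (EuclideanSpace.complexify ∘ (u.1 : UnitAddTorus (Fin 3) → EuclideanSpace ℝ (Fin 3))) k = 0) → 0 ≤ MvPolynomial.eval (fun j => Torus.pairing u.1 (g j)) P) →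
      (∃ u : Torus.energySpace (Fin 3), IsLevel N u ∧ (∀ k : Fin 3 → ℤ, k 2 ≠ 0 → UnitAddTorus.mFourierCoeff (EuclideanSpace.complexify ∘ (u.1 : UnitAddTorus (Fin 3) → EuclideanSpace ℝ (Fin 3))) k = 0) ∧ MvPolynomial.eval (fun j => Torus.pairing u.1 (g j)) P ≠ 0) →
      0 < ∫ u : Torus.energySpace (Fin 3), MvPolynomial.eval (fun j => Torus.pairing u.1 (g j)) P ∂μ₁) ∧
      (∀ (m : ℕ) (g : Fin m → UnitAddTorus (Fin 3) → EuclideanSpace ℝ (Fin 3)) (P : MvPolynomial (Fin m) ℝ),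
      (∀ i, (IsBandTest N (g i) ∧ (∀ k : Fin 3 → ℤ, k 2 ≠ 0 → UnitAddTorus.mFourierCoeff (EuclideanSpace.complexify ∘ (g i)) k = 0))) → P.totalDegree + 1 ≤ 3 →
      Integrable (fun u : Torus.energySpace (Fin 3) => Torus.nsGeneratorPairing ν f u (polyGrad g P u)) μ₁ ∧
      ∫ u : Torus.energySpace (Fin 3), Torus.nsGeneratorPairing ν f u (polyGrad g P u) ∂μ₁ = 0) ∧
      Torus.ensembleEnergy μ₁ = Torus.ensembleEnergy μ₀ ∧
      Torus.ensembleDissipation ν μ₁ = Torus.ensembleDissipation ν μ₀ := by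
  sorry

/-- **K1 — THE PLANAR/SCALAR ORDER-2 DESIGN, ONE EXPLICIT `x₃`-INVARIANT FORCE (replaces S6; the
LOAD-BEARING / hardest stub).** There are an `x₃`-invariant smooth solenoidal mean-zero force
`f = (g, h)(x₁,x₂)`, budgets `E = 2`, `ε = 1/4` and `ν₀ > 0` such that for every `ν ∈ (0,ν₀)` there is
`N₀(ν) = K_w(ν) + 2`, `K_w(ν) ≍ ν^{-1/2}`, such that for EVERY `N ≥ N₀` a probability law `μ₀` carried
by planar level-`N` fields, with bounded support and nondegenerate covariance on `W_N`, has: all LINEAR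
rows against planar band tests exact, the FOUR quadratic Casimir rows (energy, helicity, scalar
variance, planar enstrophy) exact, mean energy `≤ E` and dissipation `≥ ε` — uniformly in `N ≥ N₀` and `ν`.
The design (card §Lever/(a), triage r1-2 order-2 budget check, this seat's NOTES.md §K1): mean flow
`ū = (V_ν, w̄)` with `V_ν = V + νV₁(ν)` a two-shell planar profile and `w̄ = 0.9 sin 2πx₁`; planar
fluctuations `v'` on a fixed low-mode set with covariance `C_ν = C₀ + νD_ν + Σ s_k(ν)K_k ≻ 0`; scalar
fluctuations: a low block cross-correlated with `v'` (flux `−E∫w'(v'·∇w̄) = ε₀ > 0`) plus an isotropic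
shell of variance `E_sh` at radius `K_w(ν) = (ε₀/(4π²νE_sh))^{1/2}` carrying `νE‖∇w'‖² = ε₀ − ν‖∇w̄‖²`;
small independent jitter on every planar frame mode (nondegeneracy). FORCE, `ν`-INDEPENDENT:
`g := ℙ(V·∇V) + E_{C₀}ℙ(v'·∇v')`, `h := V·∇w̄ + div E_{C₀}(v'w')`. Rows: planar linear row
`g = ℙ(V_ν·∇V_ν) + E_{C_ν}ℙ(v'·∇v') − νΔV_ν` and scalar linear row `h = V_ν·∇w̄ + div E(v'w') − νΔw̄` are
RANGE conditions on the linear stress maps `C ↦ E_Cℙ(v'·∇v')`, `C^{vw} ↦ div E(v'w')` over the chosen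
low modes (finite rank checks; pairs of equal modulus do not feed their sum in 2-D, so use `|p| ≠ |q|`);
the energy and enstrophy rows reduce (using `(ℙ(V·∇V),V) = 0 = (V·∇ζ̄, ζ̄)` on `T²`) to the two SCALAR
tunings `(g, V_ν) = ν(‖∇V_ν‖² + E‖∇v'‖²)`, `(curl g, curl V_ν) = ν(‖∇ζ̄‖² + E‖∇ζ'‖²)` — solvable because
`g` is two-shell (`g`, `Δg` independent) via `V₁` and the kernel variances `s_k` (phase-isotropic
single-wavevector energy has constant stress); the variance row is `(h, w̄) = ν(‖∇w̄‖² + E‖∇w'‖²) = ε₀`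
(the shell); the helicity (`X`) row is void under the reflection `x₁ ↦ −x₁` of the design (`ζ` odd, `w`
even) or tuned by one scalar. Numbers (triage r1-2): `‖V‖² = E‖v'‖² = E‖w'_low‖² = 0.45`, `E_sh = 0.2`,
`‖w̄‖² = 0.405`: energy `1.955 ≤ 2`; flux ceiling `‖∇w̄‖_∞·0.45 ≈ 2.5 ≫ ε₀ = 1/4` (cross block PSD with
margin); force floor (Disproof §C) `ε ≤ ‖f‖₂√E` with `‖h‖₂ ≍ 1`; level ceiling (§A) met by the scalar
shell, `N ≥ K_w(ν) + 2`. Why it might fail: an overlooked rigid coupling among the order-≤2 rows of the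
planar sector (e.g. if `g` were single-shell the energy and enstrophy rows would pin all planar energy to
one shell — Marchioro at order 2; excluded by the two-shell choice), or the finite range checks failing
for the chosen mode set (then enlarge it). Size L–XL (explicit trigonometric bookkeeping in two sectors,
four Casimir rows, a pushforward/mixture law; cf. the lead's S6 infrastructure `AtomRows`,
`AtomicMeasure`, `ModeCalculus`, `Helicity`). -/
theorem stub_planarDesign :
    ∃ f : UnitAddTorus (Fin 3) → EuclideanSpace ℝ (Fin 3), Torus.IsSmooth f ∧ Torus.IsDivFree f ∧ Torus.HasZeroMean f ∧
    (∀ k : Fin 3 → ℤ, k 2 ≠ 0 → UnitAddTorus.mFourierCoeff (EuclideanSpace.complexify ∘ (f)) k = 0) ∧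
    ∃ E ε ν₀ : ℝ, 0 < ε ∧ 0 < ν₀ ∧ ∀ ν : ℝ, 0 < ν → ν < ν₀ → ∃ N₀ : ℕ, ∀ N : ℕ, N₀ ≤ N →
    ∃ μ₀ : Measure (Torus.energySpace (Fin 3)), IsProbabilityMeasure μ₀ ∧ (∀ᵐ u ∂μ₀, IsLevel N u ∧ (∀ k : Fin 3 → ℤ, k 2 ≠ 0 → UnitAddTorus.mFourierCoeff (EuclideanSpace.complexify ∘ (u.1 : UnitAddTorus (Fin 3) → EuclideanSpace ℝ (Fin 3))) k = 0)) ∧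
    (∃ R : ℝ, ∀ᵐ u ∂μ₀, ‖u‖ ≤ R) ∧
    (∀ g : UnitAddTorus (Fin 3) → EuclideanSpace ℝ (Fin 3), (IsBandTest N (g) ∧ (∀ k : Fin 3 → ℤ, k 2 ≠ 0 → UnitAddTorus.mFourierCoeff (EuclideanSpace.complexify ∘ (g)) k = 0)) →
      (∃ u : Torus.energySpace (Fin 3), IsLevel N u ∧ (∀ k : Fin 3 → ℤ, k 2 ≠ 0 → UnitAddTorus.mFourierCoeff (EuclideanSpace.complexify ∘ (u.1 : UnitAddTorus (Fin 3) → EuclideanSpace ℝ (Fin 3))) k = 0) ∧ Torus.pairing u.1 g ≠ 0) →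
      (∫ u : Torus.energySpace (Fin 3), Torus.pairing u.1 g ∂μ₀) ^ 2 < ∫ u : Torus.energySpace (Fin 3), (Torus.pairing u.1 g) ^ 2 ∂μ₀) ∧
    (∀ g : UnitAddTorus (Fin 3) → EuclideanSpace ℝ (Fin 3), (IsBandTest N (g) ∧ (∀ k : Fin 3 → ℤ, k 2 ≠ 0 → UnitAddTorus.mFourierCoeff (EuclideanSpace.complexify ∘ (g)) k = 0)) →
      Integrable (fun u : Torus.energySpace (Fin 3) => Torus.nsGeneratorPairing ν f u g) μ₀ ∧
      ∫ u : Torus.energySpace (Fin 3), Torus.nsGeneratorPairing ν f u g ∂μ₀ = 0) ∧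
    (Integrable (fun u : Torus.energySpace (Fin 3) => Torus.nsGeneratorPairing ν f u (Torus.fourierTruncate N (u.1 : UnitAddTorus (Fin 3) → EuclideanSpace ℝ (Fin 3)))) μ₀ ∧
      ∫ u : Torus.energySpace (Fin 3), Torus.nsGeneratorPairing ν f u (Torus.fourierTruncate N (u.1 : UnitAddTorus (Fin 3) → EuclideanSpace ℝ (Fin 3))) ∂μ₀ = 0) ∧
    (Integrable (fun u : Torus.energySpace (Fin 3) => Torus.nsGeneratorPairing ν f u (BDSV.curl (Torus.fourierTruncate N (u.1 : UnitAddTorus (Fin 3) → EuclideanSpace ℝ (Fin 3))))) μ₀ ∧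
      ∫ u : Torus.energySpace (Fin 3), Torus.nsGeneratorPairing ν f u (BDSV.curl (Torus.fourierTruncate N (u.1 : UnitAddTorus (Fin 3) → EuclideanSpace ℝ (Fin 3)))) ∂μ₀ = 0) ∧
    (Integrable (fun u : Torus.energySpace (Fin 3) => Torus.nsGeneratorPairing ν f u (fun x => Torus.planarEmbed ((0 : EuclideanSpace ℝ (Fin 2)), (Torus.fourierTruncate N (u.1 : UnitAddTorus (Fin 3) → EuclideanSpace ℝ (Fin 3)) x) 2))) μ₀ ∧
      ∫ u : Torus.energySpace (Fin 3), Torus.nsGeneratorPairing ν f u (fun x => Torus.planarEmbed ((0 : EuclideanSpace ℝ (Fin 2)), (Torus.fourierTruncate N (u.1 : UnitAddTorus (Fin 3) → EuclideanSpace ℝ (Fin 3)) x) 2)) ∂μ₀ = 0) ∧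
    (Integrable (fun u : Torus.energySpace (Fin 3) => Torus.nsGeneratorPairing ν f u (fun x => Torus.laplacian (fun y => Torus.planarEmbed (Torus.planarProjE (Torus.fourierTruncate N (u.1 : UnitAddTorus (Fin 3) → EuclideanSpace ℝ (Fin 3)) y), (0 : ℝ))) x)) μ₀ ∧
      ∫ u : Torus.energySpace (Fin 3), Torus.nsGeneratorPairing ν f u (fun x => Torus.laplacian (fun y => Torus.planarEmbed (Torus.planarProjE (Torus.fourierTruncate N (u.1 : UnitAddTorus (Fin 3) → EuclideanSpace ℝ (Fin 3)) y), (0 : ℝ))) x) ∂μ₀ = 0) ∧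
    Torus.ensembleEnergy μ₀ ≤ E ∧ ε ≤ Torus.ensembleDissipation ν μ₀ := by
  sorry


/-! ## The composition (kernel-checked, no `sorry` of its own) -/

/-- **`QuarticGate` from the seven stubs.** Take `f, E, ε, ν₀` from K1 and `ν_j := ν₀/(j+2)`
(positive, `< ν₀`, `→ 0`). At each `j`: K1 gives `N₀`; K2's frequently-many clean levels meet `N ≥ N₀`
(`Frequently.and_eventually`); at such `N`, K1 gives the loud planar order-2 design `μ₀`, S5W (fed
QuadRigidity_W) a Slater-on-`W_N` 3-stationary `μ₁` with the same energy/dissipation, S3W (fed S1W and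
NoCubicCasimir_W) a defect certificate for `μ₁`, S4W the law `μ`, 4-stationary against planar band
tests with the same energy `≤ E` and dissipation `≥ ε`, and K3 (row closure, `f` planar) upgrades it to
4-stationarity against all band tests; `quarticGate_iff` (definitional) closes. -/
theorem QuarticGate_of : QuarticGate := by
  obtain ⟨f, hfs, hfd, hfz, hfp, E, ε, ν₀, hε, hν₀, hK1⟩ := stub_planarDesign
  have hνpos : ∀ j : ℕ, 0 < ν₀ / ((j : ℝ) + 2) := fun j => div_pos hν₀ (by positivity)
  have hνlt : ∀ j : ℕ, ν₀ / ((j : ℝ) + 2) < ν₀ := fun j => by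
    rw [div_lt_iff₀ (by positivity)]
    nlinarith [(Nat.cast_nonneg j : (0 : ℝ) ≤ j)]
  have hνlim : Tendsto (fun j : ℕ => ν₀ / ((j : ℝ) + 2)) atTop (nhds 0) :=
    tendsto_const_nhds.div_atTop
      (tendsto_atTop_add_const_right atTop (2 : ℝ) tendsto_natCast_atTop_atTop)
  refine quarticGate_iff.2
    ⟨f, hfs, hfd, hfz, fun j => ν₀ / ((j : ℝ) + 2), E, ε, hνpos, hνlim, hε, fun j => ?_⟩
  obtain ⟨N₀, hN₀⟩ := hK1 _ (hνpos j) (hνlt j)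
  refine (stub_discCasimirs.and_eventually (eventually_ge_atTop N₀)).mono ?_
  rintro N ⟨⟨hCub, hQuad⟩, hN⟩
  obtain ⟨μ₀, hp₀, hl₀, hR₀, hnd₀, hlin₀, hErow₀, hHrow₀, hWrow₀, hZrow₀, hE₀, hD₀⟩ := hN₀ N hN
  obtain ⟨μ₁, hp₁, hl₁, hi₁, hsl₁, hst₁, hE₁, hD₁⟩ :=
    stub_order3SurgeryW _ f N μ₀ hfs hp₀ hl₀ hR₀ hnd₀ hlin₀ hErow₀ hHrow₀ hWrow₀ hZrow₀ hQuad
  obtain ⟨M, v, c, hcert⟩ :=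
    stub_defectCertificateW stub_signLemmaW N hCub _ f hfs μ₁ hp₁ hl₁ hi₁
  obtain ⟨μ, hp, hl, hi, hst, hE, hD⟩ :=
    stub_surgeryW _ f N μ₁ hfs hp₁ hl₁ hi₁ hsl₁ hst₁ M v c hcert
  have hst' : IsPolyStationary (ν₀ / ((j : ℝ) + 2)) f N 4 μ :=
    stub_rowClosure _ f N 4 μ hfs hfp hp hl hi hst
  refine ⟨μ, hp, hl.mono fun u hu => hu.1, hi, hst', ?_, ?_⟩
  · rw [hE, hE₁]; exact hE₀
  · rw [hD, hD₁]; exact hD₀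

end Summit.AnomalousDissipation.AnomalousDissipation.Cruxes.QuarticGate.PassiveThirdComponent
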